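import Mathlib
import Summits.KontsevichZagierPeriods.Zeta5Search.UniversalDigitW
import Summits.KontsevichZagierPeriods.Zeta5Search.SecondOrderDigit
import HarnessLib

/-!
# ζ(5) search — THEOREM B TO SECOND ORDER: the second `p`-adic digit of the partial-fraction coefficients

Cell `pub-zeta5` (HONEST FRAMING: systematic search; no irrationality claim unless certified), typer seat generation 11.
Part 1 of the Lean proof of gen-2 g10's CLASSWISE SECOND-DIGIT LEMMA (`SecondOrder.SecondDigitW`, REPORT-gen2-g10 §1 (L1)–(L2)).
Theorem B (`leadingDigit_holds`, typer g8) reads the coefficient `c_{σ−1,q} = [X^κ] Gser b q` (`κ = n_q − σ`) to FIRST order off the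
factorisation `Gser = Gnear · Gfar`; here the far part is expanded one step further,
`Gfar = ĝ_q + ĝ_q φ_q · X + O(X²)` with **`[X¹] Gfar = ĝ_q · φ_q`**, `φ_q = phiHat b p q = Σ_{s ∉ class} netExp(s)/(s − q) (+ centre)`
(the logarithmic derivative of the foreign factor, `coeff_one_Gfar`), whence the EXACT-PLUS-ERROR form
`c_{σ−1,q} = (−p)^{σ+E_x} ĝ_q (ρ_{q,σ} − p φ_q ρ_{q,σ+1}[σ+1 ≤ n_q]) + O(p^{σ+E_x+2})` (`leadingDigit₂`, in `padicNorm` form).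
Power-series algebra over `ℚ` and the slope bounds of `PadicCoeffBound`; nothing here concerns irrationality.
-/

noncomputable section

open Finset PowerSeries

namespace Summit.KontsevichZagierPeriods.Zeta5Search.SecondOrder

open Summit.KontsevichZagierPeriods.Zeta5Search.DualSeries (InBox)
open Summit.KontsevichZagierPeriods.Zeta5Search.WedgeDictionary (pfData)
open Summit.KontsevichZagierPeriods.Zeta5Search.CasoratianValuation (InPolytope)
open Summit.KontsevichZagierPeriods.Zeta5Search.ClusterValuation
open Summit.KontsevichZagierPeriods.Zeta5Search.PadicSeries
open Summit.KontsevichZagierPeriods.Zeta5Search.CellA (padicNorm_classRho_le_one pfData_eq_zero_of_order_le gHat_classCongr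
  padicNorm_sub_eq_one_of_mod_ne padicNorm_zpow_unit)

variable {p : ℕ} [hp : Fact p.Prime]

/-! ### The first Taylor coefficient of a finite product (logarithmic derivative at `0`) -/

omit hp in
/-- `[X⁰]` of a finite product. -/
theorem coeff_zero_prod' {ι : Type*} (s : Finset ι) (F : ι → PowerSeries ℚ) :
    coeff 0 (∏ i ∈ s, F i) = ∏ i ∈ s, coeff 0 (F i) := by
  simp only [coeff_zero_eq_constantCoeff, map_prod]

omit hp in
/-- `[X¹](A·B) = [X⁰]A·[X¹]B + [X¹]A·[X⁰]B`. -/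
theorem coeff_one_mul' (A B : PowerSeries ℚ) :
    coeff 1 (A * B) = coeff 0 A * coeff 1 B + coeff 1 A * coeff 0 B := by
  rw [coeff_mul, Nat.sum_antidiagonal_eq_sum_range_succ_mk, sum_range_succ, sum_range_succ, sum_range_zero]
  simp

omit hp in
/-- **Logarithmic derivative of a finite product**: if every constant term is non-zero,
`[X¹]∏ F_i = (∏ [X⁰]F_i) · Σ_i [X¹]F_i / [X⁰]F_i`. -/
theorem coeff_one_prod {ι : Type*} (s : Finset ι) (F : ι → PowerSeries ℚ) (h0 : ∀ i ∈ s, coeff 0 (F i) ≠ 0) :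
    coeff 1 (∏ i ∈ s, F i) = (∏ i ∈ s, coeff 0 (F i)) * ∑ i ∈ s, coeff 1 (F i) / coeff 0 (F i) := by
  classical
  induction s using Finset.induction_on with
  | empty => simp
  | insert a s ha ih =>
    rw [prod_insert ha, prod_insert ha, sum_insert ha, coeff_one_mul', coeff_zero_prod',
      ih fun i hi => h0 i (mem_insert_of_mem hi)]
    have ha0 : coeff 0 (F a) ≠ 0 := h0 a (mem_insert_self a s)
    field_simp
    ring

/-! ### The far factors as binomial series -/

omit hp in
/-- A factor of `Gser` at a position `s ≠ q` is the binomial series `(X + (s−q))^{netExp s}`. -/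
theorem factorS_eq_binomSeries (b : ℕ → ℤ) {q s : ℕ} (hsq : s ≠ q) :
    factorS b q s = binomSeries ((s : ℚ) - q) (netExp b s) := by
  have hδ : ((s : ℚ) - q) ≠ 0 := sub_ne_zero.2 (by exact_mod_cast hsq)
  have hm : ((mult b s : ℕ) : ℤ) - 6 = netExp b s := by have := mult_eq_netExp b s; omega
  rw [factorS, linS, linS_pow_mul_inv_eq_binomSeries hδ, hm]

omit hp in
/-- `[X⁰]` of a far factor: `(s−q)^{netExp s}`. -/
theorem coeff_zero_factorS (b : ℕ → ℤ) {q s : ℕ} (hsq : s ≠ q) :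
    coeff 0 (factorS b q s) = ((s : ℚ) - q) ^ netExp b s := by
  rw [factorS_eq_binomSeries b hsq, coeff_binomSeries, Ring.choose_zero_right]
  simp

omit hp in
/-- `[X¹]` of a far factor: `netExp s · (s−q)^{netExp s − 1}`. -/
theorem coeff_one_factorS (b : ℕ → ℤ) {q s : ℕ} (hsq : s ≠ q) :
    coeff 1 (factorS b q s) = (netExp b s : ℚ) * ((s : ℚ) - q) ^ (netExp b s - 1) := by
  rw [factorS_eq_binomSeries b hsq, coeff_binomSeries, Ring.choose_one_right]
  simp

/-! ### `[X¹] Gfar = ĝ_q · φ_q` -/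

omit hp in
/-- **The first Taylor coefficient of the far part is `ĝ_q · φ_q`** (`φ_q = phiHat b p q`). -/
theorem coeff_one_Gfar (b : ℕ → ℤ) (h0 : 0 ≤ b 0) {q : ℕ} (hq : q ≤ (b 0).toNat) :
    coeff 1 (Gfar b p q) = gHat b p q * phiHat b p q := by
  have hb0 : ((((b 0).toNat : ℕ) : ℚ)) = ((b 0 : ℤ) : ℚ) := by exact_mod_cast Int.toNat_of_nonneg h0
  set S := (range ((b 0).toNat + 1)).filter (fun s => s % p ≠ q % p) with hS
  have hSfar : ((range ((b 0).toNat + 1)).erase q).filter (fun s : ℕ => ¬ (p : ℤ) ∣ (s : ℤ) - q) = S := by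
    rw [hS, farSet_eq b hq]
  have hne : ∀ s ∈ S, s ≠ q := by
    intro s hs h; subst h; exact (mem_filter.1 hs).2 rfl
  have h0S : ∀ s ∈ S, coeff 0 (factorS b q s) ≠ 0 := by
    intro s hs
    rw [coeff_zero_factorS b (hne s hs)]
    exact zpow_ne_zero _ (sub_ne_zero.2 (by exact_mod_cast hne s hs))
  -- the product over the far positions
  have hP0 : coeff 0 (∏ s ∈ S, factorS b q s) = ∏ s ∈ S, ((s : ℚ) - q) ^ netExp b s := by
    rw [coeff_zero_prod']
    exact prod_congr rfl fun s hs => coeff_zero_factorS b (hne s hs)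
  have hP1 : coeff 1 (∏ s ∈ S, factorS b q s) =
      (∏ s ∈ S, ((s : ℚ) - q) ^ netExp b s) * ∑ s ∈ S, (netExp b s : ℚ) / ((s : ℚ) - q) := by
    rw [coeff_one_prod S _ h0S, ← hP0, coeff_zero_prod']
    congr 1
    refine sum_congr rfl fun s hs => ?_
    have hδ : ((s : ℚ) - q) ≠ 0 := sub_ne_zero.2 (by exact_mod_cast hne s hs)
    rw [coeff_one_factorS b (hne s hs), coeff_zero_factorS b (hne s hs), zpow_sub_one₀ hδ]
    field_simp
  have hC1 : ∀ c : ℚ, coeff 1 (C c) = 0 := fun c => by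
    rw [show (1 : ℕ) = 0 + 1 from rfl, coeff_C, if_neg (by norm_num)]
  have hg : gHat b p q = 2 * (∏ s ∈ S, ((s : ℚ) - q) ^ netExp b s) *
      (if ¬ (2 : ℤ) ∣ b 0 ∧ ¬ CentreIn b p q then ((b 0 : ℤ) : ℚ) / 2 - q else 1) := rfl
  have hφ : phiHat b p q = (∑ s ∈ S, (netExp b s : ℚ) / ((s : ℚ) - q))
      + (if ¬ (2 : ℤ) ∣ b 0 ∧ ¬ CentreIn b p q then 1 / (((b 0 : ℤ) : ℚ) / 2 - q) else 0) := rfl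
  rw [Gfar, hSfar, coeff_one_mul', hP0, hP1, hg, hφ]
  generalize (∏ s ∈ S, ((s : ℚ) - q) ^ netExp b s) = P
  generalize (∑ s ∈ S, (netExp b s : ℚ) / ((s : ℚ) - q)) = Q
  by_cases hc : ¬ (2 : ℤ) ∣ b 0 ∧ CentreIn b p q
  · -- odd `b₀`, centre inside the class: the far centre factor is the constant `2`
    rw [if_pos hc, if_neg (fun h => h.2 hc.2), if_neg (fun h => h.2 hc.2), coeff_zero_C, hC1]
    ring
  · rw [if_neg hc]
    by_cases hev : (2 : ℤ) ∣ b 0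
    · -- even `b₀`: centre factor `2`
      rw [if_neg (fun h => h.1 hev), if_neg (fun h => h.1 hev), cenP, if_pos hev, Polynomial.coe_C, coeff_zero_C, hC1]
      ring
    · -- odd `b₀`, centre outside the class: centre factor `2X + (b₀ − 2q)`
      have hnc : ¬ CentreIn b p q := fun h => hc ⟨hev, h⟩
      have hcq : ((b 0 : ℤ) : ℚ) / 2 - q ≠ 0 := by
        intro h
        apply hnc
        have h2 : (2 * (q : ℤ) - b 0 : ℤ) = 0 := by
          have : (2 * (q : ℚ) - (b 0 : ℚ)) = 0 := by linarith
          exact_mod_cast this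
        exact ⟨0, by rw [h2]; ring⟩
      have e0 : coeff 0 ((cenP b q : Polynomial ℚ) : PowerSeries ℚ) = ((b 0 : ℤ) : ℚ) - 2 * q := by
        rw [cenP, if_neg hev, Polynomial.coe_add, Polynomial.coe_mul, Polynomial.coe_C, Polynomial.coe_X,
          Polynomial.coe_C, map_add, coeff_zero_C, coeff_zero_eq_constantCoeff_apply, map_mul, constantCoeff_X,
          mul_zero, zero_add, hb0]
      have e1 : coeff 1 ((cenP b q : Polynomial ℚ) : PowerSeries ℚ) = 2 := by
        rw [cenP, if_neg hev, Polynomial.coe_add, Polynomial.coe_mul, Polynomial.coe_C, Polynomial.coe_X,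
          Polynomial.coe_C, map_add, hC1, add_zero, mul_comm, show (1 : ℕ) = 0 + 1 from rfl, coeff_succ_X_mul,
          coeff_zero_C]
      have hcq2 : ((b 0 : ℤ) : ℚ) - (q : ℚ) * 2 ≠ 0 := by contrapose! hcq; linarith
      have hcq3 : ((b 0 : ℤ) : ℚ) - 2 * (q : ℚ) ≠ 0 := by contrapose! hcq; linarith
      rw [if_pos ⟨hev, hnc⟩, if_pos ⟨hev, hnc⟩, e0, e1]
      field_simp

/-! ### The far part to second order -/

/-- `Gfar − ĝ_q − ĝ_q φ_q · X` has slope-`1` offset `2`: its first two coefficients vanish and the others are `p`-integral. -/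
theorem Gfar_sub_two_bound (b : ℕ → ℤ) (h0 : 0 ≤ b 0) {q : ℕ} (hq : q ≤ (b 0).toNat) (hn : (b 0).toNat < p ^ 2)
    (hp2 : p ≠ 2) :
    CoeffBound p 1 2 (Gfar b p q - C (gHat b p q) - X * C (gHat b p q * phiHat b p q)) := by
  intro k
  rw [map_sub, map_sub, coeff_C]
  rcases Nat.lt_or_ge k 2 with hk | hk
  · interval_cases k
    · rw [if_pos rfl, coeff_zero_eq_constantCoeff_apply, constantCoeff_Gfar b h0 hq,
        coeff_zero_X_mul, sub_zero, sub_self, padicNorm.zero]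
      exact zpow_p_nonneg _
    · rw [if_neg one_ne_zero, sub_zero, show (1 : ℕ) = 0 + 1 from rfl, coeff_succ_X_mul, coeff_zero_C,
        coeff_one_Gfar b h0 hq, sub_self, padicNorm.zero]
      exact zpow_p_nonneg _
  · obtain ⟨i, rfl⟩ : ∃ i, k = i + 1 := ⟨k - 1, by omega⟩
    rw [if_neg (by omega), sub_zero, coeff_succ_X_mul, coeff_C, if_neg (by omega), sub_zero]
    refine ((Gfar_integral b hq hn hp2) (i + 1)).trans (zpow_le_zpow_right₀ one_le_p ?_)
    push_cast; omega

/-- **THEOREM B TO SECOND ORDER.** In the window `p² > b₀ + 2`, `p ≥ 5`, for a pole `q` of order `n_q = −netExp q` and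
`1 ≤ σ ≤ n_q`:  `‖c_{σ−1,q} − (−p)^{σ+E_x} ĝ_q (ρ_{q,σ} − p φ_q ρ_{q,σ+1}[σ+1 ≤ n_q])‖_p ≤ p^{−(σ+E_x+2)}`. -/
theorem leadingDigit₂ (b : ℕ → ℤ) (hb : InPolytope b) (hp5 : 5 ≤ p) (hwin : (b 0 + 2 : ℤ) < (p : ℤ) ^ 2)
    {q σ : ℕ} (hq : q ≤ (b 0).toNat) (hσ1 : 1 ≤ σ) (hσ : (σ : ℤ) ≤ -netExp b q) :
    padicNorm p (pfData b (σ - 1) q - (-(p : ℚ)) ^ ((σ : ℤ) + classExp b p q) * gHat b p q *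
        (classRho b p q σ - (p : ℚ) * phiHat b p q *
          (if (σ : ℤ) + 1 ≤ -netExp b q then classRho b p q (σ + 1) else 0))) ≤
      (p : ℚ) ^ (-((σ : ℤ) + classExp b p q + 2)) := by
  obtain ⟨hbox, hhalf, hpf, hn⟩ := thmA_data b hb hwin
  have h0 : 0 ≤ b 0 := hbox.1
  have hp2 : p ≠ 2 := by omega
  have hp0 : p ≠ 0 := hp.out.ne_zero
  have hp' : (-(p : ℚ)) ≠ 0 := neg_ne_zero.2 (Nat.cast_ne_zero.2 hp0)
  have hm := mult_eq_netExp b q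
  have hid := pf_eq_coeff_Gser b hbox hhalf hpf hq (show σ - 1 < 6 by omega)
  rw [coeff_X_pow_mul', if_pos (by omega)] at hid
  set κ := 5 - (σ - 1) - mult b q with hκ
  set g := gHat b p q with hg
  set φ := phiHat b p q with hφ
  set E := classExp b p q with hE
  -- split `Gser = Gnear·ĝ + X·(Gnear·ĝφ) + Gnear·R`
  set R := Gfar b p q - C g - X * C (g * φ) with hR
  have hsplit : Gser b q = Gnear b p q * C g + X * (Gnear b p q * C (g * φ)) + Gnear b p q * R := by
    rw [Gser_eq_near_mul_far b p q, hR]; ring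
  -- the exact coefficients of the near part
  have hGk : ∀ k, coeff k (Gnear b p q) = (-(p : ℚ)) ^ (E - netExp b q - k) * coeff k (classCofactor b p q) := by
    intro k
    have hres := congrArg (coeff k) (rescale_Gnear hp0 b h0 hq)
    rw [coeff_rescale, coeff_C_mul] at hres
    have e1 : (-(p : ℚ)) ^ k = (-(p : ℚ)) ^ (k : ℤ) := (zpow_natCast _ _).symm
    rw [e1] at hres
    have hk0 : (-(p : ℚ)) ^ (k : ℤ) ≠ 0 := zpow_ne_zero _ hp'
    rw [← mul_right_inj' hk0, hres, ← mul_assoc, ← zpow_add₀ hp']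
    congr 2; ring
  -- the exact second-order leading term
  have hlead : coeff κ (Gnear b p q * C g + X * (Gnear b p q * C (g * φ))) =
      (-(p : ℚ)) ^ ((σ : ℤ) + E) * g *
        (classRho b p q σ - (p : ℚ) * φ * (if (σ : ℤ) + 1 ≤ -netExp b q then classRho b p q (σ + 1) else 0)) := by
    rw [map_add, coeff_mul_C, hGk κ, classRho, show (-netExp b q).toNat - σ = κ by omega,
      show E - netExp b q - (κ : ℤ) = (σ : ℤ) + E by omega]
    rcases Nat.eq_zero_or_pos κ with hκ0 | hκpos
    · -- `σ = n_q`: no `X`-term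
      rw [hκ0, coeff_zero_X_mul, if_neg (by omega)]; ring
    · obtain ⟨k, hk⟩ : ∃ k, κ = k + 1 := ⟨κ - 1, by omega⟩
      rw [hk, coeff_succ_X_mul, coeff_mul_C, hGk k, if_pos (by omega), classRho,
        show (-netExp b q).toNat - (σ + 1) = k by omega, show E - netExp b q - (k : ℤ) = (σ : ℤ) + E + 1 by omega,
        zpow_add_one₀ hp']
      ring
  -- the error term
  have herr : CoeffBound p 1 (E - netExp b q + 2) (Gnear b p q * R) :=
    (Gnear_bound b h0 hq hn hp2).mul (Gfar_sub_two_bound b h0 hq hn hp2)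
  have hdiff : pfData b (σ - 1) q - (-(p : ℚ)) ^ ((σ : ℤ) + E) * g *
      (classRho b p q σ - (p : ℚ) * φ * (if (σ : ℤ) + 1 ≤ -netExp b q then classRho b p q (σ + 1) else 0)) =
      coeff κ (Gnear b p q * R) := by
    rw [hid, hsplit, map_add, hlead]; ring
  rw [hdiff]
  refine (herr κ).trans (le_of_eq ?_)
  congr 1; omega

end Summit.KontsevichZagierPeriods.Zeta5Search.SecondOrder

end
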